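import Summits.CriticalPhenomena.PercolationContinuityZ3.Theorems.PercNearOneGluingNoHeavyLowerTailFibreSwitchingSplit
import Summits.CriticalPhenomena.PercolationContinuityZ3.Theorems.PercNearOneGluingNoHeavyLowerTailFibreSwitchingSHK3
import Summits.CriticalPhenomena.PercolationContinuityZ3.Theorems.PercNearOneGluingNoHeavyLowerTailThreeCopyFibre
import Literature.Probability.Percolation.KozmaNitzanSeparatingTriple
import HarnessLib

/-!
# `NoHeavyLowerTail` (stmt-CriticalPhenomena-4575) — TERMINAL-EDGE CLOSURE of three-copy fibre positivity of `H_{q+t}`, I: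
# the sunflower poset `M3`, the Gladkov kernels, the `decide`d step certificates, and the type of `insert s(a,b) K`
# (Part II `…FibreSwitchingTerminalEdge` assembles the theorem stated below)

Support file (new-inequality factory seat `prim-ineq-gen-1`, gen 6; `--supports stmt-CriticalPhenomena-4575`).  No named facts, no sorries.

`R2 = M(HQT)` — nonnegativity of every three-copy fibre sum of the kernel `ThreeCopy.hqtKernel` of
`H_{q+t} = (q+t)(qt − e₂(u)) − e₃(u)` on the three-point types — is the factory's open measure-free conjecture
(census-validated on all 3-terminal multigraphs with ≤ 7 vertices and ≤ 10 edges; it implies `H_{q+t} ≥ 0`, `AG⁺`,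
`SHK3⁺` on every product measure, `ThreeCopy.hqt_nonneg_of_fibres`).  This file proves the first INDUCTIVE STEP for it
(FINDING-12 §2, found as an exact LP certificate, kit j081016):

**Theorem (`hqt_fibre_nonneg_insert_terminal_edge`).**  Let `a ≠ b`, `c` be vertices and `s(a,b) ∉ D`.  If
`0 ≤ Σ_{y ∈ fibre D k'} hqtKernel (code y₀) (code y₁) (code y₂)` for every profile `k'`, then
`0 ≤ Σ_{x ∈ fibre (insert s(a,b) D) k} hqtKernel (code x₀) (code x₁) (code x₂)` for every profile `k`.
(Adding an edge between two TERMINALS preserves fibre positivity of `H_{q+t}`; so a minimal counterexample to `R2` has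
no terminal–terminal edge.)

**Proof.**  Split the fibre along the new coordinate (`FibreSplit.sum_fibre_insert`): the copies holding `s(a,b)` have
type `τ ∨ Pc` (`code_insert_ab`: `Q ↦ Pc`, `Pa, Pb ↦ T`, via `KNSep.reachable_insert_iff`).  Multiplicity `0` is the
hypothesis, multiplicity `3` is identically `0` (`hqt_join3`).  For multiplicities `1` and `2` the step kernels `K1, K2`
dominate, POINTWISE on type triples (`cert_one`, `cert_two`, `decide`), `6·hqtKernel + Σ_{π ∈ S₃} env₁ ∘ π` resp.
`Σ_π env₂ ∘ π`, where `envᵣ(τ₁,τ₂,τ₃) = 3·κ(τ₁,τ₂)·[τ₃ ∈ E]` are ENVIRONMENT-CONDITIONED Gladkov kernels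
(`ag`, `agm` — chain-nonnegative and submodular on the sunflower poset `M3`, `decide`); their fibre sums are `≥ 0`
by the environment decomposition `FibreEnv.sum_fibre_env_kernel_nonneg`, and fibres are invariant under the six copy
permutations (`FibreSHK3.sum_fibre_comp_perm`).
-/

namespace Summit.CriticalPhenomena.PercolationContinuityZ3.Theorems

namespace FibreTermEdge

open Finset FibreSwitching FibreEnv FibreSplit FibreSHK3 ThreeCopy
open Literature.Probability.Percolation Literature.Probability.Percolation.DecisionTree
open Literature.Probability.Percolation.Gladkov

noncomputable section

open Classical

/-! ### The sunflower poset `M3` on the five three-point types and the two Gladkov kernels -/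

/-- The five three-point types as a poset: `Q < Pa, Pb, Pc < T` (codes `0 < 1,2,3 < 4`, petals incomparable). [this work] -/
structure M3 where
  /-- the underlying code -/
  v : Fin 5
  deriving DecidableEq

namespace M3

/-- The sunflower order: `x ≤ y` iff `x = y` or `x = Q` or `y = T`. [this work] -/
def le (x y : M3) : Prop := x.v = y.v ∨ x.v = 0 ∨ y.v = 4

/-- The order relation is decidable. [this work] -/
instance : DecidableRel le := fun x y => by unfold le; infer_instance

/-- `M3` is finite (five elements). [this work] -/
instance : Fintype M3 := Fintype.ofEquiv (Fin 5) ⟨fun i => ⟨i⟩, fun x => x.v, fun _ => rfl, fun _ => rfl⟩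

/-- The sunflower preorder on `M3`. [this work] -/
instance : Preorder M3 where
  le := le
  le_refl x := Or.inl rfl
  le_trans x y z hxy hyz := by
    unfold le at *
    rcases hxy with h | h | h <;> rcases hyz with h' | h' | h'
    all_goals first | (left; omega) | (right; left; omega) | (right; right; omega)

/-- Unfolding `≤` on `M3`. [this work] -/
theorem le_iff (x y : M3) : x ≤ y ↔ (x.v = y.v ∨ x.v = 0 ∨ y.v = 4) := Iff.rfl

/-- `≤` on `M3` is decidable. [this work] -/
instance decLE : DecidableRel (fun x y : M3 => x ≤ y) := fun x y => inferInstanceAs (Decidable (M3.le x y))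

end M3

/-- Gladkov's (strong Harris) kernel on codes: `(Q,T),(T,Q) ↦ 1`, two DISTINCT petals `↦ −1`, else `0`. [this work] -/
def ag (x y : Fin 5) : ℤ :=
  if (x = 0 ∧ y = 4) ∨ (x = 4 ∧ y = 0) then 1
  else if (x = 1 ∨ x = 2 ∨ x = 3) ∧ (y = 1 ∨ y = 2 ∨ y = 3) ∧ x ≠ y then -1 else 0

/-- The same kernel with the `{Pa, Pb}` pairs dropped (only petal pairs involving `Pc` are `−1`). [this work] -/
def agm (x y : Fin 5) : ℤ :=
  if (x = 0 ∧ y = 4) ∨ (x = 4 ∧ y = 0) then 1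
  else if (x = 3 ∧ (y = 1 ∨ y = 2)) ∨ (y = 3 ∧ (x = 1 ∨ x = 2)) then -1 else 0

/-- `ag` is nonnegative on chains of `M3`. [this work] -/
theorem ag_chain : ∀ x y : M3, x ≤ y → (0 : ℤ) ≤ ag x.v y.v := by
  rintro ⟨x⟩ ⟨y⟩ h
  rw [M3.le_iff] at h
  revert h; revert x y
  decide

/-- `ag` is submodular on comparable rectangles of `M3`. [this work] -/
theorem ag_submod : ∀ a₀ a₁ b₀ b₁ : M3, a₀ ≤ a₁ → b₀ ≤ b₁ →
    ag a₁.v b₁.v + ag a₀.v b₀.v ≤ ag a₁.v b₀.v + ag a₀.v b₁.v := by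
  rintro ⟨a₀⟩ ⟨a₁⟩ ⟨b₀⟩ ⟨b₁⟩ h h'
  rw [M3.le_iff] at h h'
  revert h h'; revert a₀ a₁ b₀ b₁
  decide

/-- `agm` is nonnegative on chains of `M3`. [this work] -/
theorem agm_chain : ∀ x y : M3, x ≤ y → (0 : ℤ) ≤ agm x.v y.v := by
  rintro ⟨x⟩ ⟨y⟩ h
  rw [M3.le_iff] at h
  revert h; revert x y
  decide

/-- `agm` is submodular on comparable rectangles of `M3`. [this work] -/
theorem agm_submod : ∀ a₀ a₁ b₀ b₁ : M3, a₀ ≤ a₁ → b₀ ≤ b₁ →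
    agm a₁.v b₁.v + agm a₀.v b₀.v ≤ agm a₁.v b₀.v + agm a₀.v b₁.v := by
  rintro ⟨a₀⟩ ⟨a₁⟩ ⟨b₀⟩ ⟨b₁⟩ h h'
  rw [M3.le_iff] at h h'
  revert h h'; revert a₀ a₁ b₀ b₁
  decide

/-! ### The `H_{q+t}` kernel on codes, the join with `Pc`, the step kernels and the certificates -/

/-- `ThreeCopy.hqtKernel` read on `Fin 5` codes (`0 = Q`, `1,2,3 =` petals, `4 = T`). [this work] -/
def hq (x y z : Fin 5) : ℤ := hqtKernel x.val y.val z.val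

/-- Join with `Pc` in the lattice of types: `Q ↦ Pc`, `Pa, Pb ↦ T`, `Pc ↦ Pc`, `T ↦ T`. [this work] -/
def joinPc (x : Fin 5) : Fin 5 := if x = 0 ∨ x = 3 then 3 else 4

/-- Step kernel for multiplicity `1` of the new edge: one copy joined with `Pc`. [this work] -/
def K1 (x y z : Fin 5) : ℤ := hq (joinPc x) y z + hq x (joinPc y) z + hq x y (joinPc z)

/-- Step kernel for multiplicity `2`: two copies joined with `Pc`. [this work] -/
def K2 (x y z : Fin 5) : ℤ :=
  hq x (joinPc y) (joinPc z) + hq (joinPc x) y (joinPc z) + hq (joinPc x) (joinPc y) z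

/-- Environment kernel of the multiplicity-`1` certificate: `3·ag` when the environment is `Pa` or `Pb`, `3·agm` when it is `T`. [this work] -/
def env1 (x y z : Fin 5) : ℤ :=
  (if z = 1 ∨ z = 2 then 3 * ag x y else 0) + (if z = 4 then 3 * agm x y else 0)

/-- Environment kernel of the multiplicity-`2` certificate: `3·agm` when the environment is `Pa`, `Pb` or `T`. [this work] -/
def env2 (x y z : Fin 5) : ℤ := if z = 1 ∨ z = 2 ∨ z = 4 then 3 * agm x y else 0

/-- Sum of a kernel over the six orderings of its arguments. [this work] -/
def sym6 (f : Fin 5 → Fin 5 → Fin 5 → ℤ) (x y z : Fin 5) : ℤ :=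
  f x y z + f y x z + f z y x + f x z y + f z x y + f y z x

/-- **Certificate, multiplicity 1** (exact LP certificate of kit j081016, checked pointwise):
`6·hqtKernel + Σ_{π ∈ S₃} env₁ ∘ π ≤ 6·K1` on every type triple. [this work] -/
theorem cert_one : ∀ x y z : Fin 5, 6 * hq x y z + sym6 env1 x y z ≤ 6 * K1 x y z := by decide

/-- **Certificate, multiplicity 2**: `Σ_{π ∈ S₃} env₂ ∘ π ≤ 6·K2` on every type triple (no induction hypothesis needed). [this work] -/
theorem cert_two : ∀ x y z : Fin 5, sym6 env2 x y z ≤ 6 * K2 x y z := by decide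

/-- With all three copies joined with `Pc` the kernel vanishes (all types lie in the chain `{Pc, T}`). [this work] -/
theorem hqt_join3 : ∀ x y z : Fin 5, hq (joinPc x) (joinPc y) (joinPc z) = 0 := by decide

/-! ### The graph side: types after adding the terminal–terminal edge, and monotonicity of the type -/

section Graph

variable {V : Type*} [Fintype V] [DecidableEq V] (a b c : V)

omit [Fintype V] in
/-- The new edge joins `a` and `b`. [this work] -/
theorem insert_mem_conn_ab (hab : a ≠ b) (K : Finset (Sym2 V)) : insert s(a, b) K ∈ conn a b :=
  mem_conn.2 (SimpleGraph.Adj.reachable (adj_iff.2 ⟨mem_insert_self _ _, hab⟩))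

omit [Fintype V] in
/-- After adding `s(a,b)`: `a ~ c` iff `a ~ c` or `b ~ c` before. [this work] -/
theorem insert_mem_conn_ac_iff (K : Finset (Sym2 V)) :
    insert s(a, b) K ∈ conn a c ↔ K ∈ conn a c ∨ K ∈ conn b c := by
  rw [mem_conn, mem_conn, mem_conn, Finset.coe_insert, KNSep.reachable_insert_iff]
  constructor
  · rintro (h | ⟨-, h⟩ | ⟨-, h⟩)
    · exact Or.inl h
    · exact Or.inr h
    · exact Or.inl h
  · rintro (h | h)
    · exact Or.inl h
    · exact Or.inr (Or.inl ⟨SimpleGraph.Reachable.refl _, h⟩)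

omit [Fintype V] in
/-- After adding `s(a,b)`: `b ~ c` iff `b ~ c` or `a ~ c` before. [this work] -/
theorem insert_mem_conn_bc_iff (K : Finset (Sym2 V)) :
    insert s(a, b) K ∈ conn b c ↔ K ∈ conn b c ∨ K ∈ conn a c := by
  rw [mem_conn, mem_conn, mem_conn, Finset.coe_insert, KNSep.reachable_insert_iff]
  constructor
  · rintro (h | ⟨-, h2⟩ | ⟨-, h⟩)
    · exact Or.inl h
    · exact Or.inl h2
    · exact Or.inr h
  · rintro (h | h)
    · exact Or.inl h
    · exact Or.inr (Or.inr ⟨SimpleGraph.Reachable.refl _, h⟩)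

omit [Fintype V] in
/-- **Adding the edge `s(a,b)` joins the type with `Pc`**: `code (insert s(a,b) K) = joinPc (code K)`. [this work] -/
theorem code_insert_ab (hab : a ≠ b) (K : Finset (Sym2 V)) :
    code a b c (insert s(a, b) K) = joinPc (code a b c K) := by
  have hab' := insert_mem_conn_ab a b hab K
  have hac' := insert_mem_conn_ac_iff a b c K
  have hbc' := insert_mem_conn_bc_iff a b c K
  rcases code_cases a b c K with ⟨h1, h2, h3, hc⟩ | ⟨h1, h2, h3, hc⟩ | ⟨h1, h2, h3, hc⟩ |
    ⟨h1, h2, h3, hc⟩ | ⟨h1, h2, h3, hc⟩ <;>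
  · rw [hc]
    unfold code
    simp only [hab', if_true, hac', hbc', h2, h3, or_false, or_true, or_self, if_false, joinPc]
    all_goals decide

/-- The type as an element of the poset `M3`. [this work] -/
def codeM3 (K : Finset (Sym2 V)) : M3 := ⟨code a b c K⟩

omit [Fintype V] [DecidableEq V] in
/-- **The type is monotone** in the configuration (for the sunflower order on `M3`). [this work] -/
theorem codeM3_mono {K L : Finset (Sym2 V)} (hKL : K ⊆ L) : codeM3 a b c K ≤ codeM3 a b c L := by
  rw [M3.le_iff]
  show code a b c K = code a b c L ∨ code a b c K = 0 ∨ code a b c L = 4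
  have m1 : K ∈ conn a b → L ∈ conn a b := fun h => isUpperSet_conn a b hKL h
  have m2 : K ∈ conn a c → L ∈ conn a c := fun h => isUpperSet_conn a c hKL h
  have m3 : K ∈ conn b c → L ∈ conn b c := fun h => isUpperSet_conn b c hKL h
  rcases code_cases a b c K with ⟨h1, h2, h3, hc⟩ | ⟨h1, h2, h3, hc⟩ | ⟨h1, h2, h3, hc⟩ |
    ⟨h1, h2, h3, hc⟩ | ⟨h1, h2, h3, hc⟩ <;>
  rcases code_cases a b c L with ⟨g1, g2, g3, gc⟩ | ⟨g1, g2, g3, gc⟩ | ⟨g1, g2, g3, gc⟩ |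
    ⟨g1, g2, g3, gc⟩ | ⟨g1, g2, g3, gc⟩ <;>
  simp_all

end Graph

end

end FibreTermEdge

end Summit.CriticalPhenomena.PercolationContinuityZ3.Theorems
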